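import Literature.MathematicalPhysics.QuantumFieldTheory.Balaban1983to89.Beta.RemainderStepAdapterHolo

/-!
# Spine/NE5/StepObjectLocal — the Z-LOCAL form of the D4 ↔ NE5 junction object: per-polymer data regions, the restriction property
# by antitonicity (cell `pub-balaban-gaps`, YM blitz Y1, track G2, seat `ne5` gen 3; follower of `StepObjectFromActivities` p343082)

Row D4's owner (an4 gen 86, first-refusal word [AN4-G86-W23] on p343082, remark R1) records that Bałaban's analyticity domains
𝔘ᶜ_{k+1}(Z, α₀, α₁) of [II] p. 15 are Z-LOCAL, whereas `Spine/NE5/StepObjectFromActivities.stepObjectOfActivities` uses ONE data region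
`V` for every localization domain.  This leaf supplies the Z-local object, over the same two landed interfaces and with nothing else:
* `stepObjectOfActivitiesLocal Φ dat act V hV : StepObjectD4 d N` — configurations `Φ`, data map `dat : Φ → Op × Hist` (the (T3)-map),
  NE5-type activities `act : Op × Hist → 𝐃 → ℂ`, and a family of data regions `V : 𝐃 → Set (Op × Hist)` ANTITONE along inclusion of
  footprints (`hV : Z ⊆ X → V X ⊆ V Z` — a larger domain carries more constraints); `sp2 X := dat ⁻¹' (V X)` and the restriction property
  `hsp` IS `hV` ([II] p. 15 *"we can restrict them, as analytic functions, to the above subspace"*);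
* `lemma3OnH_of_activities_local` — (2.38) owed PER POLYMER on `V Z` only ⟹ `Lemma3OnH c ℓ`;
* `mem_sp2_local_of_mapsTo` (`hemb`) and `differentiableOn_H_of_activities_local` — per-polymer holomorphy of `act · Z` on `V Z` + a seam at
  `X` whose data image is holomorphic on the α₂-ball INTO `V X` + `Z ⊆ X` ⟹ `DifferentiableOn ℂ (v ↦ H Z (s v)) (ball 0 α₂)`, in the exact
  shape `∀ X Z, Z.1 ⊆ X.1 → …` consumed by an4's `toPolLeavesTFac190H_ofActivities`.

HONEST FRAMING.  Bookkeeping by composition; `act`, `dat`, `V`, the seams and every bound are HYPOTHESES; nothing of Bałaban's is constructed or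
asserted; NE5 NOT PRINTED ∕ NOT PROVED, (D4) NOT discharged, NODE O instance 0∕1; 0∕12 NE5 leaves on Bałaban's objects.  Rung (B)+1 on a FIXED
finite T⁴ — NOT continuum by itself, NOT infinite volume, NOT mass gap, NOT Clay.  Spine PROVED 0∕9.  HONEST DEPENDENCY: continuum YM on T⁴ ⇐
BetaPertH ∧ nine spine estimates; BetaPertH ⇐ (D1) ∧ (D4) ∧ CAP+tail.  0 sorry; one DATA def (an instance of an4's structure `StepObjectD4`).
-/

noncomputable section

namespace Summit.QuantumFields.BalabanUV.T4Continuum.Spine.NE5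

open Set Metric
open Literature.MathematicalPhysics.QuantumFieldTheory.Balaban1983to89
open Literature.MathematicalPhysics.QuantumFieldTheory.Balaban1983to89.TreeLengthTorus (TPt TDom tsys torusTreeLen)
open Literature.MathematicalPhysics.QuantumFieldTheory.Balaban1983to89.Beta.RemainderStepAdapterHolo (StepObjectD4)

/-! ## §1 The Z-LOCAL object (row D4 owner's remark R1 on p343082): per-polymer data regions, restriction property by antitonicity -/

section Local

variable {d N : ℕ} [NeZero N]
variable {Op Hist : Type*}

/-- **THE D4 STEP OBJECT WITH Z-LOCAL ANALYTICITY DOMAINS.**  As `stepObjectOfActivities`, but the data region may depend on the localization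
domain: `sp2 X := dat ⁻¹' (V X)` for a family `V` ANTITONE along inclusion of footprints (`Z ⊆ X → V X ⊆ V Z` — more constraints on a larger
domain, [II] p. 15 *"we can restrict them, as analytic functions, to the above subspace"*), which is exactly the restriction property `hsp`.
Bałaban's 𝔘ᶜ_{k+1}(X, α₀, α₁) is of this Z-local kind (row D4 owner an4, remark R1 on p343082).  DATA. [cite: Balaban1988RG2Cluster, p.15] -/
def stepObjectOfActivitiesLocal (Φ : Type) (dat : Φ → Op × Hist) (act : Op × Hist → TDom d N → ℂ)
    (V : TDom d N → Set (Op × Hist)) (hV : ∀ X Z : TDom d N, Z.1 ⊆ X.1 → V X ⊆ V Z) : StepObjectD4 d N where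
  Φ := Φ
  sp2 := fun X => dat ⁻¹' V X
  H := fun Z φ => act (dat φ) Z
  hsp := fun X Z _ hZX hφ => hV X Z hZX hφ

variable {Φ : Type} {dat : Φ → Op × Hist} {act : Op × Hist → TDom d N → ℂ} {V : TDom d N → Set (Op × Hist)}
  {hV : ∀ X Z : TDom d N, Z.1 ⊆ X.1 → V X ⊆ V Z}

/-- The Z-local object's activities are NE5's activities at the data of the configuration. [folklore] -/
@[simp] theorem stepObjectOfActivitiesLocal_H (Z : TDom d N) (φ : Φ) :
    (stepObjectOfActivitiesLocal Φ dat act V hV).H Z φ = act (dat φ) Z := rfl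

/-- **(2.38) PER POLYMER IS `Lemma3OnH` for the Z-local object**: the majorant for `act · Z` is needed only on the polymer's own region `V Z`.
[cite: Balaban1988RG2Cluster, (2.38) p.20] -/
theorem lemma3OnH_of_activities_local {c : B13.Consts} {ℓ : ℝ}
    (hmaj : ∀ Z : TDom d N, ∀ z ∈ V Z,
      ‖act z Z‖ ≤ c.C3act * c.ε₁ * Real.exp (-((1 - 8 * c.δ) * ℓ * c.κ * torusTreeLen Z.1))) :
    (stepObjectOfActivitiesLocal Φ dat act V hV).Lemma3OnH c ℓ :=
  fun Z φ hφ => hmaj Z (dat φ) hφ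

variable {Wn : Type*} [NormedAddCommGroup Wn]

/-- The seam at `X` lands in the Z-local object's analyticity domain at `X` (row D4's `hemb`). [folklore] -/
theorem mem_sp2_local_of_mapsTo {X : TDom d N} {s : Wn → Φ} {α₂ : ℝ} (hmaps : MapsTo (fun v => dat (s v)) (ball 0 α₂) (V X)) :
    ∀ v ∈ ball (0 : Wn) α₂, s v ∈ (stepObjectOfActivitiesLocal Φ dat act V hV).sp2 X :=
  fun _ hv => hmaps hv

variable [NormedAddCommGroup Op] [NormedSpace ℂ Op] [NormedAddCommGroup Hist] [NormedSpace ℂ Hist] [NormedSpace ℂ Wn]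

/-- **The activity-holomorphy leaf for the Z-local object**: per-polymer holomorphy of `act · Z` on `V Z`, a seam at `X` whose data image is
holomorphic on the α₂-ball and stays in `V X`, and `Z ⊆ X` (so `V X ⊆ V Z`) give `DifferentiableOn ℂ (v ↦ H Z (s v)) (ball 0 α₂)` — the exact
shape `∀ n X Z, Z.1 ⊆ X.1 → …` of `toPolLeavesTFac190H_ofActivities`. [cite: Balaban1988RG2Cluster, p.15; Balaban1987RG1, (4.4) p.281] -/
theorem differentiableOn_H_of_activities_local (hhol : ∀ Z : TDom d N, DifferentiableOn ℂ (fun z : Op × Hist => act z Z) (V Z))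
    {X : TDom d N} {s : Wn → Φ} {α₂ : ℝ} (hs : DifferentiableOn ℂ (fun v => dat (s v)) (ball 0 α₂))
    (hmaps : MapsTo (fun v => dat (s v)) (ball 0 α₂) (V X)) {Z : TDom d N} (hZX : Z.1 ⊆ X.1) :
    DifferentiableOn ℂ (fun v => (stepObjectOfActivitiesLocal Φ dat act V hV).H Z (s v)) (ball 0 α₂) :=
  ((hhol Z).mono (hV X Z hZX)).comp hs hmaps

end Local

end Summit.QuantumFields.BalabanUV.T4Continuum.Spine.NE5
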